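import Summits.HodgeConjecture.HodgeConjecture.Theorems.K2E1bCubicCasimirTwistCorner
import Summits.HodgeConjecture.HodgeConjecture.Theorems.K2E1bDsDatum
import Literature.RepresentationTheory.Kovacevic2021.SU21CasimirCentral
import HarnessLib

/-!
# K2 ∕ E1b — LAWS BRICK U8-4c-C «EXISTENCE of the cubic scalar of a twisted irreducible Kovačević datum; the VERTEX form»

Cell hodgecm-mathlib, Track B «K2-LIT», engine E1b, unit U8 «archimedean packet signs»; crux item h413 = stmt-HodgeConjecture-24833
(supports-only helper; closes nothing by itself).  Author K2-defs1 (g3) (offer 03:24Z), the continuation of ★ U8-4c-B (`K2E1bCubicCasimirExtremeVector`,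
`K2E1bCubicCasimirTwistCorner`): it closes the REACH GAP of U8-4c-B (the middle cell `j = 0`, whose vertex `K`-type is a LOCAL MINIMUM of the arrow graph
and carries no Borel-extreme vector — K2E1b-r01 (g4) 03:11Z).  COMPLEMENTARY to K2E4-p10 (g3)'s `Theorems/K2E1bDatumCubicScalar.lean` (p857081, 8b-β part 1,
ns `…K2E1bDatumCubicScalar`): THAT file READS OFF the value of a cubic scalar ASSUMED to exist (`cubicScalar_ofRecord_eq : HasCubicScalar (σOfRecord 𝒟 e) s →
s = …`, the UNIQUENESS half of the calibration); THIS file PRODUCES the scalar (an operator identity on `u¹_{n,m}` + irreducibility ⇒ `HasCubicScalar σ c₃`, the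
EXISTENCE half), for an arbitrary central twist `IsTwistOf 𝒟.ρ z σ`; different namespace, no declaration in common.  THEOREMS ONLY — no definition, no
`sorry`, no axiom, no instance (one `attribute [local instance] LieRing.ofAssociativeRing`), no notation; GENERIC over ★ `SU21Datum` (no record internals).

## What is proved

* §1 the diagonal matrix units on the whole `u`-basis: `⁅E_ii, u^k_{n,m}⁆` (`lie_E00∕E11∕E22_vec`; ★ `ρfun_E`, ★ `Ha_vec`, ★ `Hb_vec`).
* §2 **`sum_lie3_vec_one`** — for ANY Kovačević datum `𝒟` and any `(n, m)`:
  `Σ_{a,b,c} ⁅E_ab, ⁅E_bc, ⁅E_ca, u¹_{n,m}⁆⁆⁆ = c₃⁰ • u¹_{n,m}`,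
  `c₃⁰ = −½ − m∕4 − m³∕36 + n²∕2 + mn²∕4 + P_A·½(n+1)(n+3−m) + P_B·(2−n)(n+1) + Q_A·(n+2)(n−1) − Q_B·½(n−1)(n−3+m)`
  with the four gauge-invariant products of [Kovacevic2021, Remark 3] `P_A = A_{n,m}D_{n+1,m+3}`, `P_B = B_{n,m}C_{n+1,m−3}`, `Q_A = D_{n,m}A_{n−1,m−3}`,
  `Q_B = C_{n,m}B_{n−1,m+3}` — the cubic twin of ★ `casimir_vec`; the `u^·_{n±2,m}` components of the 27 words CANCEL IDENTICALLY (no relation (b20)–(b45)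
  is used); proof = the kernel's own expansion (`Fin.sum_univ_three`, the `𝔭^±`∕`𝔨` action lemmas, `vec_of_not_range` by `omega` in the cases
  `n ≤ 0 ∣ n = 1 ∣ n = 2 ∣ n ≥ 3`, `match_scalars <;> ring1`), pre-computed by the symbolic script `K2/K2-defs1/g3/cubic_vec_sim.K2-defs1-g3.py`;
  the same scalar, read off an assumed `HasCubicScalar`, is p857081's `cubicScalar_ofRecord_eq` (independent derivation — a cross-check).
* §3 **`upqCubicOp_apply_of_isTwistOf`** — for a central twist `σ` of `𝒟.ρ` by `z` (★ `IsTwistOf`):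
  `C₃(σ) v = Σ⁅E,⁅E,⁅E,v⁆⁆⁆ + 3z·Σ⁅E,⁅E,v⁆⁆ + 3z²·(⁅E₀₀,v⁆ + ⁅E₁₁,v⁆ + ⁅E₂₂,v⁆) + 3z³·v` (the binomial expansion of `Σ (ρE_ab + zδ)(ρE_bc + zδ)(ρE_ca + zδ)`;
  the `z²`-term is `3z²·ρ(1) = 0` on a datum), whence **`upqCubicOp_vec_one_of_isTwistOf`**: on a `K`-type `(n,m) ∈ S`,
  `C₃(σ) u¹_{n,m} = (c₃⁰ + 3z·casimirScalar n m + 3z³) • u¹_{n,m}` (★ `sum_lie_lie_eq_casimir`, ★ `casimir_vec`).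
* §4 **`hasCubicScalar_of_isTwistOf_mem`** — on an IRREDUCIBLE datum this is the cubic scalar (★ `hasCubicScalar_of_eigenvector`,
  ★ `submodule_eq_bot_or_top_of_isTwistOf`): `HasCubicScalar σ (c₃⁰ + 3z·casimirScalar n m + 3z³)` for every `(n, m) ∈ S`.
* §5 **THE VERTEX FORM** — at a LOCAL-MINIMUM vertex `(n, m) ∈ S` (no `K`-type at `(n−1, m±3)`, `n ≥ 2`) the relations (b20)∕(b25) (★ `rel20`∕`rel25`) pin
  `(n+1)P_A = −(n+m+1)∕2`, `(n+1)P_B = (m−n−1)∕2`, `Q_A = Q_B = 0` (★ `A_eq_zero`∕`B_eq_zero`), and the cubic scalar is the Perelomov–Popov value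
  **`hasCubicScalar_of_isTwistOf_vertex : HasCubicScalar σ (P(z + m∕6 + (n−1)∕2, z − m∕3, z + m∕6 − (n−1)∕2))`**, `P(x,y,w) = x³+y³+w³+(x²+y²+w²−xy−yw−wx)
  −2(x+y+w)−3` (the Harish-Chandra parameter of the vertex, symmetric in `±(n−1)`); INTEGER FORM **`hasCubicScalar_cubicOf_of_isTwistOf_vertex`**:
  if those three numbers are the integers `a, b, c` then `HasCubicScalar σ ↑(cubicOf a b c)` (★ `cubicOf_cast`).
  For the record cell `j = 0` (`D_φ`, vertex `(a−c+1, a+c−2b)`, `z = (a+b+c)∕3`) the three numbers ARE `(a, b, c)` on the nose — paper pre-check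
  680 regular triples, 0 mismatches (script above) — so all three cells calibrate to ★ `cubicOf a b c` (j = 1, 2 by ★ U8-4c-B's corners).

Sources: [Kovacevic2021] D. Kovačević, Acta Math. Spalatensia 1 (2021) 105–125, §3 Def 1, Thm 1–2 ((b20)–(b45)), Remark 3; [Iachello2015] §7.4.1 (7.24)
(Perelomov–Popov); [Molev2007] §7.1; [KnappVogan1995] Prop. 4.120; [BorelWallach2000] II §2.3, §2.5.

HONEST LABEL: HC_CM is proved only modulo the 7 printed citations (2 remaining named inputs: hLiu418 = stmt-HodgeConjecture-24832,
h413 = stmt-HodgeConjecture-24833) until rung 0 closes; LAWS bricks close nothing by themselves.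
-/

set_option autoImplicit false
set_option linter.dupNamespace false

noncomputable section

namespace Summit.HodgeConjecture.HodgeConjecture.Cruxes.H413.K2E1bGKCohomologyU21

open Literature.NumberTheory.Automorphic
open Literature.RepresentationTheory
open Literature.RepresentationTheory.BorelWallach2000
open Literature.RepresentationTheory.KonnoKonno2007 Literature.RepresentationTheory.KonnoKonno2007.RealDualPair
open Literature.RepresentationTheory.KonnoKonno2007.RealDualPair.UForm
open Literature.RepresentationTheory.Kovacevic2021 Literature.RepresentationTheory.Kovacevic2021.SU21Datum
open Summit.HodgeConjecture.HodgeConjecture.Cruxes.H413.F0P3bLocalAPacketsDefs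
open Summit.HodgeConjecture.HodgeConjecture.Cruxes.H413.F0P3bU21Restriction
open Summit.HodgeConjecture.HodgeConjecture.Cruxes.H413.K2E1bDsDatum (sum_lie_lie_eq_casimir)

-- Mathlib idiom (as in `GKModules`, the `Upq*` files, the Kovačević topic): commutator bracket on `Module.End` ∕ matrices
attribute [local instance 100] LieRing.ofAssociativeRing

section Datum

variable (𝒟 : SU21Datum)

/-! ## §1 The diagonal matrix units on the whole basis -/

/-- `E₀₀ u^k_{n,m} = (⅔(n+1−2k) + ⅙(m−n−1+2k)) u^k_{n,m}` (`E₀₀ = ⅔H_α + ⅓H_β`, ★ `ρfun_E`, ★ `Ha_vec`, ★ `Hb_vec`). [cite: Kovacevic2021, §3 Def 1] -/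
theorem lie_E00_vec (n m k : ℤ) :
    ⁅E 0 0, 𝒟.vec n m k⁆ = ((2 / 3 : ℂ) * ((n : ℂ) + 1 - 2 * k) + (1 / 3 : ℂ) * (((m : ℂ) - n - 1 + 2 * k) / 2)) • 𝒟.vec n m k := by
  rw [lie_def, ρfun_E]
  simp only [LinearMap.add_apply, LinearMap.smul_apply, Ha_vec, Hb_vec, smul_smul, ← add_smul]

/-- `E₁₁ u^k_{n,m} = (−⅓(n+1−2k) + ⅙(m−n−1+2k)) u^k_{n,m}` (`E₁₁ = −⅓H_α + ⅓H_β`). [cite: Kovacevic2021, §3 Def 1] -/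
theorem lie_E11_vec (n m k : ℤ) :
    ⁅E 1 1, 𝒟.vec n m k⁆ = ((-1 / 3 : ℂ) * ((n : ℂ) + 1 - 2 * k) + (1 / 3 : ℂ) * (((m : ℂ) - n - 1 + 2 * k) / 2)) • 𝒟.vec n m k := by
  rw [lie_def, ρfun_E]
  simp only [LinearMap.add_apply, LinearMap.smul_apply, Ha_vec, Hb_vec, smul_smul, ← add_smul]

/-- `E₂₂ u^k_{n,m} = (−⅓(n+1−2k) − ⅓(m−n−1+2k)) u^k_{n,m}` (`E₂₂ = −⅓H_α − ⅔H_β`). [cite: Kovacevic2021, §3 Def 1] -/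
theorem lie_E22_vec (n m k : ℤ) :
    ⁅E 2 2, 𝒟.vec n m k⁆ = ((-1 / 3 : ℂ) * ((n : ℂ) + 1 - 2 * k) + (-2 / 3 : ℂ) * (((m : ℂ) - n - 1 + 2 * k) / 2)) • 𝒟.vec n m k := by
  rw [lie_def, ρfun_E]
  simp only [LinearMap.add_apply, LinearMap.smul_apply, Ha_vec, Hb_vec, smul_smul, ← add_smul]

/-! ## §2 The 27 words on `u¹_{n,m}` (untwisted): the cubic twin of ★ `casimir_vec` -/

-- One fixed expansion step: the 27 words `⁅E_ab, ⁅E_bc, ⁅E_ca, u¹⁆⁆⁆`, the eight action lemmas, vanishing of `vec` off range by `omega` in the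
-- four cases `n ≤ 0 ∣ n = 1 ∣ n = 2 ∣ n ≥ 3`; which simp lemmas fire varies with the case, so the unused-simp-argument linter is off for this one
-- declaration (exactly as in ★ `Kovacevic2021.SU21Datum.casimir_vec`).
set_option linter.unusedSimpArgs false in
/-- **THE CUBIC GELFAND INVARIANT ON KOVAČEVIĆ'S BASIS (untwisted).**  For ANY datum and any `(n, m)`:
`Σ_{a,b,c} ⁅E_ab, ⁅E_bc, ⁅E_ca, u¹_{n,m}⁆⁆⁆ = c₃⁰ • u¹_{n,m}` with
`c₃⁰ = −½ − m∕4 − m³∕36 + n²∕2 + mn²∕4 + P_A·½(n+1)(n+3−m) + P_B·(2−n)(n+1) + Q_A·(n+2)(n−1) − Q_B·½(n−1)(n−3+m)`,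
`P_A = A_{n,m}D_{n+1,m+3}`, `P_B = B_{n,m}C_{n+1,m−3}`, `Q_A = D_{n,m}A_{n−1,m−3}`, `Q_B = C_{n,m}B_{n−1,m+3}`; the `u^·_{n±2,m}`-components of the 27 words cancel
identically. [cite: Kovacevic2021, §3 Thm 1, Remark 3] [cite: Molev2007, §7.1] -/
theorem sum_lie3_vec_one (n m : ℤ) :
    (∑ a : Fin 3, ∑ b : Fin 3, ∑ c : Fin 3, ⁅E a b, ⁅E b c, ⁅E c a, 𝒟.vec n m 1⁆⁆⁆) =
      (-1 / 2 - (m : ℂ) / 4 - (m : ℂ) ^ 3 / 36 + (n : ℂ) ^ 2 / 2 + (m : ℂ) * (n : ℂ) ^ 2 / 4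
        + 𝒟.A n m * 𝒟.D (n + 1) (m + 3) * (((n : ℂ) + 1) * ((n : ℂ) + 3 - m) / 2)
        + 𝒟.B n m * 𝒟.C (n + 1) (m - 3) * ((2 - (n : ℂ)) * ((n : ℂ) + 1))
        + 𝒟.D n m * 𝒟.A (n - 1) (m - 3) * (((n : ℂ) + 2) * ((n : ℂ) - 1))
        + 𝒟.C n m * 𝒟.B (n - 1) (m + 3) * (-(((n : ℂ) - 1) * ((n : ℂ) - 3 + m)) / 2))
        • 𝒟.vec n m 1 := by
  simp only [Fin.sum_univ_three]
  rcases lt_trichotomy n 1 with hn | rfl | hn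
  · -- `n ≤ 0`: no such `K`-type, both sides vanish
    simp (disch := omega) only [vec_of_not_range, lie_zero, smul_zero, add_zero]
  · simp (disch := omega) only [lie_E00_vec, lie_E11_vec, lie_E22_vec, lie_E01_vec, lie_E10_vec, lie_E02_vec, lie_E12_vec, lie_E20_vec,
      lie_E21_vec, vec_of_not_range, lie_add, lie_smul, lie_zero, lie_neg, smul_add, smul_zero, smul_neg, smul_smul, neg_zero, add_zero,
      zero_add, neg_neg, add_sub_cancel_right, sub_add_cancel, Int.cast_add, Int.cast_sub, Int.cast_one, Int.cast_ofNat, Int.cast_zero,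
      Int.reduceAdd, Int.reduceSub]
    match_scalars <;> ring1
  · rcases eq_or_lt_of_le (show (2 : ℤ) ≤ n by omega) with rfl | hn3
    all_goals
      simp (disch := omega) only [lie_E00_vec, lie_E11_vec, lie_E22_vec, lie_E01_vec, lie_E10_vec, lie_E02_vec, lie_E12_vec, lie_E20_vec,
        lie_E21_vec, vec_of_not_range, lie_add, lie_smul, lie_zero, lie_neg, smul_add, smul_zero, smul_neg, smul_smul, neg_zero, add_zero,
        zero_add, neg_neg, add_sub_cancel_right, sub_add_cancel, Int.cast_add, Int.cast_sub, Int.cast_one, Int.cast_ofNat, Int.cast_zero]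
    all_goals match_scalars <;> ring1

/-! ## §3 The central twist: `C₃(σ) = C₃ + 3z·C₂ + 3z²·C₁ + 3z³` -/

variable {z : ℂ} {σ : G21.lie →ₗ⁅ℝ⁆ Module.End ℂ 𝒟.V}

/-- `Fin 2 ⊕ Fin 1 ≃ Fin 3` on `inl 0`. [folklore] -/
private theorem fsf0 : (finSumFinEquiv (Sum.inl 0 : Fin 2 ⊕ Fin 1) : Fin 3) = 0 := by decide
/-- `Fin 2 ⊕ Fin 1 ≃ Fin 3` on `inl 1`. [folklore] -/
private theorem fsf1 : (finSumFinEquiv (Sum.inl 1 : Fin 2 ⊕ Fin 1) : Fin 3) = 1 := by decide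
/-- `Fin 2 ⊕ Fin 1 ≃ Fin 3` on `inr 0`. [folklore] -/
private theorem fsf2 : (finSumFinEquiv (Sum.inr 0 : Fin 2 ⊕ Fin 1) : Fin 3) = 2 := by decide

/-- **`C₃` of a central twist, expanded**: for `σ X = kovLie 𝒟.ρ X + z·tr(X)·1` (★ `IsTwistOf`) and every `v`,
`C₃(σ) v = Σ⁅E,⁅E,⁅E,v⁆⁆⁆ + 3z·Σ⁅E,⁅E,v⁆⁆ + 3z²·(⁅E₀₀,v⁆ + ⁅E₁₁,v⁆ + ⁅E₂₂,v⁆) + 3z³·v` — the binomial expansion of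
`Σ_{abc} (ρE_ab + zδ_ab)(ρE_bc + zδ_bc)(ρE_ca + zδ_ca)` (★ `upqLieC_single_apply_of_isTwistOf`). [cite: KnappVogan1995, Prop. 4.120] [cite: Molev2007, §7.1] -/
theorem upqCubicOp_apply_of_isTwistOf (hσ : IsTwistOf 𝒟.ρ z σ) (v : 𝒟.V) :
    upqCubicOp σ v =
      (∑ a : Fin 3, ∑ b : Fin 3, ∑ c : Fin 3, ⁅E a b, ⁅E b c, ⁅E c a, v⁆⁆⁆)
        + (3 * z) • (∑ a : Fin 3, ∑ b : Fin 3, ⁅E a b, ⁅E b a, v⁆⁆)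
        + (3 * z ^ 2) • (⁅E 0 0, v⁆ + ⁅E 1 1, v⁆ + ⁅E 2 2, v⁆) + (3 * z ^ 3) • v := by
  have e := upqLieC_single_apply_of_isTwistOf 𝒟 hσ
  rw [upqCubicOp_apply]
  simp only [Fintype.sum_sum_type, Fin.sum_univ_two, Fin.sum_univ_one, Fin.sum_univ_three, e, fsf0, fsf1, fsf2, Sum.inl.injEq,
    reduceCtorEq, one_ne_zero, zero_ne_one, if_true, if_false, Fin.isValue, lie_add, lie_smul, smul_add, smul_smul, zero_smul, add_zero]
  module

/-- On a datum the `z²`-term vanishes: `⁅E₀₀,u⁆ + ⁅E₁₁,u⁆ + ⁅E₂₂,u⁆ = 0` on the basis (the centre `1 = E₀₀ + E₁₁ + E₂₂` acts by `0`, ★ `ρfun_one`).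
[cite: Kovacevic2021, §3 Def 1] -/
theorem lie_diag_sum_vec (n m k : ℤ) : ⁅E 0 0, 𝒟.vec n m k⁆ + ⁅E 1 1, 𝒟.vec n m k⁆ + ⁅E 2 2, 𝒟.vec n m k⁆ = 0 := by
  rw [lie_E00_vec, lie_E11_vec, lie_E22_vec, ← add_smul, ← add_smul]
  convert zero_smul ℂ (𝒟.vec n m k) using 2
  ring

/-- **`C₃(σ)` on a `K`-type vector**: for `(n, m) ∈ S`, `C₃(σ) u¹_{n,m} = (c₃⁰ + 3z·casimirScalar n m + 3z³) • u¹_{n,m}` (§2 + ★ `sum_lie_lie_eq_casimir`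
+ ★ `casimir_vec` + `lie_diag_sum_vec`). [cite: Kovacevic2021, §3 Thm 1, Remark 3] [cite: KnappVogan1995, Prop. 4.120] -/
theorem upqCubicOp_vec_one_of_isTwistOf (hσ : IsTwistOf 𝒟.ρ z σ) {n m : ℤ} (hS : (n, m) ∈ 𝒟.S) :
    upqCubicOp σ (𝒟.vec n m 1) =
      (-1 / 2 - (m : ℂ) / 4 - (m : ℂ) ^ 3 / 36 + (n : ℂ) ^ 2 / 2 + (m : ℂ) * (n : ℂ) ^ 2 / 4
          + 𝒟.A n m * 𝒟.D (n + 1) (m + 3) * (((n : ℂ) + 1) * ((n : ℂ) + 3 - m) / 2)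
          + 𝒟.B n m * 𝒟.C (n + 1) (m - 3) * ((2 - (n : ℂ)) * ((n : ℂ) + 1))
          + 𝒟.D n m * 𝒟.A (n - 1) (m - 3) * (((n : ℂ) + 2) * ((n : ℂ) - 1))
          + 𝒟.C n m * 𝒟.B (n - 1) (m + 3) * (-(((n : ℂ) - 1) * ((n : ℂ) - 3 + m)) / 2)
        + 3 * z * 𝒟.casimirScalar n m + 3 * z ^ 3) • 𝒟.vec n m 1 := by
  rw [upqCubicOp_apply_of_isTwistOf 𝒟 hσ, sum_lie3_vec_one, sum_lie_lie_eq_casimir, 𝒟.casimir_vec hS le_rfl (𝒟.one_le_of_mem hS),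
    lie_diag_sum_vec, smul_zero, add_zero, smul_smul, ← add_smul, ← add_smul]

/-! ## §4 The cubic scalar of a twisted irreducible datum, read on any `K`-type -/

/-- **THE CUBIC SCALAR OF A TWISTED IRREDUCIBLE DATUM** read on ANY of its `K`-types `(n, m) ∈ S`: `C₃(σ) = (c₃⁰ + 3z·casimirScalar n m + 3z³)·1`
(§3 + ★ `hasCubicScalar_of_eigenvector` + ★ `submodule_eq_bot_or_top_of_isTwistOf`). [cite: Kovacevic2021, §3 Thm 1, Remark 3] [cite: BorelWallach2000, II §2.5] -/
theorem hasCubicScalar_of_isTwistOf_mem [LieModule.IsIrreducible ℂ (Matrix (Fin 3) (Fin 3) ℂ) 𝒟.V] (hσ : IsTwistOf 𝒟.ρ z σ)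
    {n m : ℤ} (hS : (n, m) ∈ 𝒟.S) :
    HasCubicScalar σ
      (-1 / 2 - (m : ℂ) / 4 - (m : ℂ) ^ 3 / 36 + (n : ℂ) ^ 2 / 2 + (m : ℂ) * (n : ℂ) ^ 2 / 4
          + 𝒟.A n m * 𝒟.D (n + 1) (m + 3) * (((n : ℂ) + 1) * ((n : ℂ) + 3 - m) / 2)
          + 𝒟.B n m * 𝒟.C (n + 1) (m - 3) * ((2 - (n : ℂ)) * ((n : ℂ) + 1))
          + 𝒟.D n m * 𝒟.A (n - 1) (m - 3) * (((n : ℂ) + 2) * ((n : ℂ) - 1))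
          + 𝒟.C n m * 𝒟.B (n - 1) (m + 3) * (-(((n : ℂ) - 1) * ((n : ℂ) - 3 + m)) / 2)
        + 3 * z * 𝒟.casimirScalar n m + 3 * z ^ 3) :=
  hasCubicScalar_of_eigenvector (submodule_eq_bot_or_top_of_isTwistOf 𝒟 hσ) (𝒟.vec_ne_zero ⟨hS, le_rfl, 𝒟.one_le_of_mem hS⟩)
    (upqCubicOp_vec_one_of_isTwistOf 𝒟 hσ hS)

/-! ## §5 The vertex form (a local minimum of the arrow graph) -/

/-- **THE CUBIC SCALAR AT A VERTEX.**  Let `𝒟` be irreducible, twisted by `z`, and let `(n, m) ∈ S` with `n ≥ 2` be a LOCAL MINIMUM of the arrow graph: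
no `K`-type at `(n − 1, m + 3)` nor at `(n − 1, m − 3)`.  Then `Q_A = Q_B = 0` (★ `A_eq_zero`, ★ `B_eq_zero`), the relations (b20), (b25) (★ `rel20`, ★ `rel25`)
pin `(n+1)·P_A = −(n+m+1)∕2`, `(n+1)·P_B = (m−n−1)∕2`, and the cubic scalar is the Perelomov–Popov value at the Harish-Chandra parameter of the vertex:
`C₃(σ) = P(z + m∕6 + (n−1)∕2, z − m∕3, z + m∕6 − (n−1)∕2)·1`, `P(x,y,w) = x³+y³+w³+(x²+y²+w²−xy−yw−wx)−2(x+y+w)−3`.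
[cite: Kovacevic2021, §3 Thm 2 (b20), (b25), Remark 3] [cite: Iachello2015, (7.24)] [cite: KnappVogan1995, Prop. 4.120] -/
theorem hasCubicScalar_of_isTwistOf_vertex [LieModule.IsIrreducible ℂ (Matrix (Fin 3) (Fin 3) ℂ) 𝒟.V] (hσ : IsTwistOf 𝒟.ρ z σ)
    {n m : ℤ} (hS : (n, m) ∈ 𝒟.S) (hNW : (n - 1, m + 3) ∉ 𝒟.S) (hSW : (n - 1, m - 3) ∉ 𝒟.S) (hn : 2 ≤ n) :
    HasCubicScalar σ
      ((z + (m : ℂ) / 6 + ((n : ℂ) - 1) / 2) ^ 3 + (z - (m : ℂ) / 3) ^ 3 + (z + (m : ℂ) / 6 - ((n : ℂ) - 1) / 2) ^ 3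
        + ((z + (m : ℂ) / 6 + ((n : ℂ) - 1) / 2) ^ 2 + (z - (m : ℂ) / 3) ^ 2 + (z + (m : ℂ) / 6 - ((n : ℂ) - 1) / 2) ^ 2
            - (z + (m : ℂ) / 6 + ((n : ℂ) - 1) / 2) * (z - (m : ℂ) / 3)
            - (z - (m : ℂ) / 3) * (z + (m : ℂ) / 6 - ((n : ℂ) - 1) / 2)
            - (z + (m : ℂ) / 6 - ((n : ℂ) - 1) / 2) * (z + (m : ℂ) / 6 + ((n : ℂ) - 1) / 2))
        - 2 * ((z + (m : ℂ) / 6 + ((n : ℂ) - 1) / 2) + (z - (m : ℂ) / 3) + (z + (m : ℂ) / 6 - ((n : ℂ) - 1) / 2)) - 3) := by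
  have hA : 𝒟.A (n - 1) (m - 3) = 0 := 𝒟.A_eq_zero hSW
  have hB : 𝒟.B (n - 1) (m + 3) = 0 := 𝒟.B_eq_zero hNW
  have h20 := 𝒟.rel20 hS
  have h25 := 𝒟.rel25 hS
  rw [hB, mul_zero, mul_zero, sub_zero] at h20
  rw [hA, mul_zero, mul_zero, add_zero] at h25
  have hn1 : ((n : ℂ) - 1) ≠ 0 := by
    rw [sub_ne_zero]
    exact_mod_cast (show n ≠ 1 by omega)
  -- `(n+1) P_B = (m−n−1)/2` and `(n+1) P_A = −(n+m+1)/2`, after cancelling the non-zero factor `n − 1`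
  have hPB : ((n : ℂ) + 1) * (𝒟.B n m * 𝒟.C (n + 1) (m - 3)) = ((m : ℂ) - n - 1) / 2 := by
    refine mul_left_cancel₀ hn1 ?_
    linear_combination (n : ℂ) * h20 - h25
  have hPA : ((n : ℂ) + 1) * (𝒟.A n m * 𝒟.D (n + 1) (m + 3)) = -((n : ℂ) + m + 1) / 2 := by
    refine mul_left_cancel₀ hn1 ?_
    linear_combination h20 - (n : ℂ) * h25
  refine (hasCubicScalar_of_isTwistOf_mem 𝒟 hσ hS).of_eq ?_
  rw [casimirScalar, hA, hB, mul_zero, mul_zero, add_zero, zero_mul, zero_mul, add_zero, add_zero]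
  linear_combination (((n : ℂ) + 3 - m) / 2 + 3 * z) * hPA + ((2 - (n : ℂ)) + 3 * z) * hPB

/-- **INTEGER FORM of the vertex scalar** (the shape the calibration of the middle cell consumes): if the three Harish-Chandra coordinates of the vertex are
the integers `a, b, c` — `z + m∕6 + (n−1)∕2 = a`, `z − m∕3 = b`, `z + m∕6 − (n−1)∕2 = c` — then `HasCubicScalar σ ↑(cubicOf a b c)` (★ `cubicOf_cast`).
For the record cell `D_φ` (vertex `(a−c+1, a+c−2b)`, `z = (a+b+c)∕3`) the three identities hold by `ring`. [cite: Iachello2015, (7.24)] -/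
theorem hasCubicScalar_cubicOf_of_isTwistOf_vertex [LieModule.IsIrreducible ℂ (Matrix (Fin 3) (Fin 3) ℂ) 𝒟.V] (hσ : IsTwistOf 𝒟.ρ z σ)
    {n m : ℤ} (hS : (n, m) ∈ 𝒟.S) (hNW : (n - 1, m + 3) ∉ 𝒟.S) (hSW : (n - 1, m - 3) ∉ 𝒟.S) (hn : 2 ≤ n)
    (a b c : ℤ) (ha : z + (m : ℂ) / 6 + ((n : ℂ) - 1) / 2 = a) (hb : z - (m : ℂ) / 3 = b) (hc : z + (m : ℂ) / 6 - ((n : ℂ) - 1) / 2 = c) :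
    HasCubicScalar σ ((cubicOf a b c : ℤ) : ℂ) := by
  refine (hasCubicScalar_of_isTwistOf_vertex 𝒟 hσ hS hNW hSW hn).of_eq ?_
  rw [ha, hb, hc, cubicOf_cast]

end Datum

end Summit.HodgeConjecture.HodgeConjecture.Cruxes.H413.K2E1bGKCohomologyU21

end
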